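import Literature.AlgebraicGeometry.Motives.MixedHodgeStructureWeightTest
import Literature.AlgebraicGeometry.Motives.SchemePairLongExactSequence
import Mathlib.LinearAlgebra.TensorProduct.Prod
import HarnessLib

/-!
# Weights across a morphism of pairs inducing an isomorphism on relative cohomology
# (the Mayer–Vietoris step of Hodge III, Thm. 8.2.4 (iii) / Prop. 8.2.5, on the package of
# mixed Hodge structures of pairs)

Theorems-only sequel to `MixedHodgeStructureWeightTest` (the weight test: exactness of `Gr^W` on
elements) and `SchemePairLongExactSequence` (the long exact sequence of a pair of varieties in
pair form). Setting: `M : MixedHodgeStructureOfPair k` a package of mixed Hodge structures on the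
rational cohomology of pairs of `k`-varieties (`k ⊆ ℂ`; the hypothesis structure of
`MixedHodgeStructureOfPair.lean`, inhabited by Deligne's theorem `existsDeligne`), and a morphism of
pairs of varieties `φ : (X̃, F) ⟶ (X, D)` whose pull-back
`φ^* : Hⁿ⁺¹(X(ℂ), D(ℂ); ℚ) → Hⁿ⁺¹(X̃(ℂ), F(ℂ); ℚ)` is bijective — the situation of an **abstract
blow-up / resolution square** `F = φ⁻¹(D) ⊂ X̃ →φ X ⊃ D`, `φ` proper and an isomorphism off `D`
(excision), which is how Deligne's weight bounds for singular varieties are proved by induction on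
the dimension (P. Deligne, *Théorie de Hodge III*, Publ. Math. IHÉS 44 (1974), Thm. 8.2.4 (iii):
"si `X` est propre, alors `h^{pq} = 0` pour `p + q > n`", i.e. `W_n Hⁿ(X) = Hⁿ(X)`; Prop. 8.2.5: for
`π : Y → X` proper surjective with `Y` smooth, `Ker π^* = W_{n-1} Hⁿ(X)`; cf. the hypercovering
proof printed there, (8.2.5.2), and El Zein's / Guillén–Navarro Aznar's proofs by resolution
squares).

From the two long exact sequences of the pairs and the identity of morphisms of pairs
`(X̃, ∅) → (X̃, F) → (X, D) = (X̃, ∅) → (X, ∅) → (X, D)` one gets the **Mayer–Vietoris property at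
`Hⁿ⁺¹(X)`** (`SchemePair.exists_boundary_of_map_eq_zero`): a class `y ∈ Hⁿ⁺¹(X(ℂ); ℚ)` dying on
`X̃` and on `D` is `j_X (u)` for a relative class `u ∈ Hⁿ⁺¹(X, D)` with `φ^* u = ∂ v`,
`v ∈ Hⁿ(F(ℂ); ℚ)`; when `φ^*` is bijective, `y = j_X ((φ^*)⁻¹ (∂ v))` lies in the image of the
composite morphism of mixed Hodge structures `Hⁿ(F) →∂ Hⁿ⁺¹(X̃, F) ≅ Hⁿ⁺¹(X, D) → Hⁿ⁺¹(X)`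
(`boundary_hom`, the inverse of the bijective morphism `φ^*` — `Hom.exists_inverse` —, `map_hom`).
The weight test then gives:

* `MixedHodgeStructureOfPair.mem_W_of_bijective_map` — if `W_w Hⁿ(F) = Hⁿ(F)`, then every
  `y ∈ Hⁿ⁺¹(X)` with `φ^* y ∈ W_w Hⁿ⁺¹(X̃)` and `y|_D ∈ W_w Hⁿ⁺¹(D)` lies in `W_w Hⁿ⁺¹(X)`
  (with `w = n`: the inductive step of Prop. 8.2.5, "a class dying on `X̃` and of weight `≤ n` on
  `D` has weight `≤ n`");
* `MixedHodgeStructureOfPair.W_eq_top_of_bijective_map` — if `W_w Hⁿ(F) = Hⁿ(F)`,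
  `W_w Hⁿ⁺¹(X̃) = Hⁿ⁺¹(X̃)` and `W_w Hⁿ⁺¹(D) = Hⁿ⁺¹(D)`, then `W_w Hⁿ⁺¹(X) = Hⁿ⁺¹(X)` (with
  `w = n + 1`: the inductive step of Thm. 8.2.4 (iii), weights `≤ n + 1` on `Hⁿ⁺¹` of a proper
  variety from its resolution, its discriminant and the exceptional locus).

Also: the abstract two-morphism forms of the weight test used here (targets in different
universes are allowed): `MixedHodgeStructure.mem_baseChange_inf_ker`,
`MixedHodgeStructure.mem_W_of_map_mem_W₂`, `MixedHodgeStructure.W_eq_top_of_map₂`; the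
naturality of the connecting homomorphism in pair form (`SchemePair.bettiCohomology.boundary_comp_map`,
left out of `SchemePairLongExactSequence`) with the consequence
`SchemePair.bettiCohomology.map_fD_injective` (`Hⁿ(D) ↪ Hⁿ(F)` when `φ^*` is bijective on the
pairs and `φ_X^*` is injective — e.g. a principalization of `D ⊂ X`); and the weight box at the
level of `W` (`MixedHodgeStructure.W_pred_eq_of_forall_piece_eq_bot`,
`MixedHodgeStructureOfPair.W_two_mul_eq_top`, `W_neg_one_eq_bot`, `isPure_zero`: `H⁰` of a pair of
varieties is pure of weight `0`, the degree-`0` base of the inductions).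

What is NOT here (the remaining inputs of Deligne's induction): the bijectivity of `φ^*` for an
actual resolution square on complex points (excision for compact triangulable pairs), the
existence of resolution squares (Hironaka, in the tree: `Resolution.Hironaka1964_projective_holds`),
the smooth case of Prop. 8.2.5 (`f^*` injective for `f` surjective between smooth projective
varieties), and the dimension bookkeeping of the induction. No definitions, no named facts.

## References

* [DeligneHodgeIII1974] P. Deligne, Théorie de Hodge III, Publ. Math. IHÉS 44 (1974), Thm. 8.2.4
  (iii), Prop. 8.2.5, (8.2.5.2) (pp. 38–39).
* [DeligneHodgeII1971] P. Deligne, Théorie de Hodge II, Publ. Math. IHÉS 40 (1971), Thm. 2.3.5.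
* [CattaniElZeinGriffithsLe2014] E. Cattani, F. El Zein, P. Griffiths, Lê D. T. (eds.), Hodge
  Theory (2014), Cor. 3.2.21 (ii) (exactness of `Gr^W`), Thm. 3.2.18 (proof, p. 161).
* [Hatcher2002] A. Hatcher, Algebraic Topology (2002), §3.1 p. 200 (long exact sequence of a
  pair, naturality).
-/

open scoped TensorProduct

noncomputable section

open CategoryTheory AlgebraicGeometry
open Literature.AlgebraicTopology.SingularHomology

namespace Literature.AlgebraicGeometry.Motives

/-! ### The weight test with two test morphisms (targets in arbitrary universes) -/

namespace MixedHodgeStructure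

universe u v₁ v₂ v₃

variable {V : Type u} [AddCommGroup V] [Module ℚ V]
variable {V₁ : Type v₁} [AddCommGroup V₁] [Module ℚ V₁]
variable {V₂ : Type v₂} [AddCommGroup V₂] [Module ℚ V₂]

/-- **Joint kernel of two maps under base change**: if `(g₁)_ℂ x = 0` and `(g₂)_ℂ x = 0` then
`x ∈ (ker g₁ ∩ ker g₂)_ℂ` (the kernel of `V → V₁ × V₂`, flatness of `ℂ/ℚ`, and
`ℂ ⊗ (V₁ × V₂) ≅ (ℂ ⊗ V₁) × (ℂ ⊗ V₂)`, Mathlib's `TensorProduct.prodRight`). [folklore] -/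
theorem mem_baseChange_inf_ker (g₁ : V →ₗ[ℚ] V₁) (g₂ : V →ₗ[ℚ] V₂) {x : ℂ ⊗[ℚ] V}
    (hx₁ : g₁.baseChange ℂ x = 0) (hx₂ : g₂.baseChange ℂ x = 0) :
    x ∈ (LinearMap.ker g₁ ⊓ LinearMap.ker g₂).baseChange ℂ := by
  rw [← LinearMap.ker_prod, ← ker_baseChange, LinearMap.mem_ker]
  apply (TensorProduct.prodRight ℚ ℂ ℂ V₁ V₂).injective
  rw [map_zero]
  have key : ∀ z : ℂ ⊗[ℚ] V, TensorProduct.prodRight ℚ ℂ ℂ V₁ V₂ ((g₁.prod g₂).baseChange ℂ z) =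
      (g₁.baseChange ℂ z, g₂.baseChange ℂ z) := by
    intro z
    induction z using TensorProduct.induction_on with
    | zero => simp only [map_zero, Prod.mk_zero_zero]
    | tmul c v =>
      rw [LinearMap.baseChange_tmul, LinearMap.baseChange_tmul, LinearMap.baseChange_tmul,
        TensorProduct.prodRight_tmul]
      rfl
    | add a b ha hb => rw [map_add, map_add, ha, hb, map_add, map_add, Prod.mk_add_mk]
  rw [key, hx₁, hx₂, Prod.mk_zero_zero]

variable {H : MixedHodgeStructure V} {H₁ : MixedHodgeStructure V₁} {H₂ : MixedHodgeStructure V₂}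

/-- A morphism of MHS kills every `s ∈ ⊕_p I^{p,w-p}` which it maps into `W_{w-1,ℂ}`
(`Hom.map_deligneI_le` and `(⊕_p I^{p,w-p}) ∩ W_{w-1,ℂ} = 0`). [folklore] -/
theorem Hom.baseChange_apply_eq_zero_of_mem_iSup_deligneI {V' : Type v₃} [AddCommGroup V']
    [Module ℚ V'] {H' : MixedHodgeStructure V'} (g : Hom H H') {w : ℤ} {s : ℂ ⊗[ℚ] V}
    (hs : s ∈ ⨆ p, H.deligneI p (w - p))
    (hgs : g.toLinearMap.baseChange ℂ s ∈ (H'.W (w - 1)).baseChange ℂ) :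
    g.toLinearMap.baseChange ℂ s = 0 := by
  have h1 : g.toLinearMap.baseChange ℂ s ∈ ⨆ p, H'.deligneI p (w - p) := by
    have hle : (⨆ p, H.deligneI p (w - p)).map (g.toLinearMap.baseChange ℂ) ≤
        ⨆ p, H'.deligneI p (w - p) := by
      rw [Submodule.map_iSup]
      exact iSup_mono fun p ↦ g.map_deligneI_le p (w - p)
    exact hle ⟨s, hs, rfl⟩
  have h3 : g.toLinearMap.baseChange ℂ s ∈
      (⨆ p, H'.deligneI p (w - p)) ⊓ (H'.W (w - 1)).baseChange ℂ := ⟨h1, hgs⟩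
  rwa [H'.iSup_deligneI_inf_W_pred_eq_bot w, Submodule.mem_bot] at h3

/-- If `1 ⊗ b = s + b'` with `b' ∈ W_{w-1,ℂ}` and `g b ∈ W_k`, `k < w`, then
`g_ℂ s ∈ W_{w-1,ℂ}`. [folklore] -/
theorem Hom.baseChange_apply_mem_W_pred {V' : Type v₃} [AddCommGroup V'] [Module ℚ V']
    {H' : MixedHodgeStructure V'} (g : Hom H H') {k w : ℤ} (hkw : k < w) {b : V}
    {s b' : ℂ ⊗[ℚ] V} (hsb : s + b' = (1 : ℂ) ⊗ₜ[ℚ] b) (hb' : b' ∈ (H.W (w - 1)).baseChange ℂ)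
    (hb : g.toLinearMap b ∈ H'.W k) :
    g.toLinearMap.baseChange ℂ s ∈ (H'.W (w - 1)).baseChange ℂ := by
  have e : g.toLinearMap.baseChange ℂ s =
      g.toLinearMap.baseChange ℂ ((1 : ℂ) ⊗ₜ[ℚ] b) - g.toLinearMap.baseChange ℂ b' := by
    rw [← hsb, map_add, add_sub_cancel_right]
  rw [e]
  refine Submodule.sub_mem _ ?_ (g.map_baseChange_W_le (w - 1) ⟨b', hb', rfl⟩)
  rw [LinearMap.baseChange_tmul]
  exact Submodule.baseChange_mono ℂ (H'.monotone_W (show k ≤ w - 1 by omega))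
    (Submodule.tmul_mem_baseChange_of_mem 1 hb)

/-- **One step of the descent, two test morphisms** (cf. `mem_W_pred_of_forall_map_mem_W`):
`ker g₁ ∩ ker g₂ ⊆ W_k H`, `b ∈ W_w H`, `w > k`, `g₁ b ∈ W_k H₁`, `g₂ b ∈ W_k H₂` give
`b ∈ W_{w-1} H`. [cite: CattaniElZeinGriffithsLe2014, Cor. 3.2.21 (ii)] -/
theorem mem_W_pred_of_map_mem_W₂ (g₁ : Hom H H₁) (g₂ : Hom H H₂) {k w : ℤ} (hkw : k < w)
    (hker : LinearMap.ker g₁.toLinearMap ⊓ LinearMap.ker g₂.toLinearMap ≤ H.W k) {b : V}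
    (hb₁ : g₁.toLinearMap b ∈ H₁.W k) (hb₂ : g₂.toLinearMap b ∈ H₂.W k) (hbw : b ∈ H.W w) :
    b ∈ H.W (w - 1) := by
  refine mem_of_one_tmul_mem_baseChange _ ?_
  have hbC : (1 : ℂ) ⊗ₜ[ℚ] b ∈ (H.W w).baseChange ℂ := Submodule.tmul_mem_baseChange_of_mem 1 hbw
  rw [H.W_eq_iSup_deligneI_sup w] at hbC
  obtain ⟨s, hs, b', hb', hsb⟩ := Submodule.mem_sup.1 hbC
  have hs₁ : g₁.toLinearMap.baseChange ℂ s = 0 :=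
    g₁.baseChange_apply_eq_zero_of_mem_iSup_deligneI hs
      (g₁.baseChange_apply_mem_W_pred hkw hsb hb' hb₁)
  have hs₂ : g₂.toLinearMap.baseChange ℂ s = 0 :=
    g₂.baseChange_apply_eq_zero_of_mem_iSup_deligneI hs
      (g₂.baseChange_apply_mem_W_pred hkw hsb hb' hb₂)
  have hsW : s ∈ (H.W (w - 1)).baseChange ℂ :=
    Submodule.baseChange_mono ℂ (hker.trans (H.monotone_W (show k ≤ w - 1 by omega)))
      (mem_baseChange_inf_ker g₁.toLinearMap g₂.toLinearMap hs₁ hs₂)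
  rw [← hsb]
  exact Submodule.add_mem _ hsW hb'

/-- **The weight test with two test morphisms** (exactness of `Gr^W`, element form; cf.
`mem_W_of_forall_map_mem_W`): if `ker g₁ ∩ ker g₂ ⊆ W_k H` (e.g. the joint kernel is the image of
a morphism from a structure with `W_k = ⊤`, `inf_ker_le_W_of_le_range₂`), `g₁ b ∈ W_k H₁` and
`g₂ b ∈ W_k H₂`, then `b ∈ W_k H`. [cite: CattaniElZeinGriffithsLe2014, Cor. 3.2.21 (ii)]
[cite: DeligneHodgeII1971, Thm. 2.3.5] -/
theorem mem_W_of_map_mem_W₂ (g₁ : Hom H H₁) (g₂ : Hom H H₂) {k : ℤ}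
    (hker : LinearMap.ker g₁.toLinearMap ⊓ LinearMap.ker g₂.toLinearMap ≤ H.W k) {b : V}
    (hb₁ : g₁.toLinearMap b ∈ H₁.W k) (hb₂ : g₂.toLinearMap b ∈ H₂.W k) : b ∈ H.W k := by
  obtain ⟨t, ht⟩ := H.exists_W_eq_top
  have start : b ∈ H.W (k + ((t - k).toNat : ℕ)) := by
    rcases le_or_gt k t with h | h
    · rw [Int.toNat_of_nonneg (show 0 ≤ t - k by omega), add_sub_cancel, ht]
      exact Submodule.mem_top
    · exact H.monotone_W (show t ≤ k + ((t - k).toNat : ℕ) by omega) (ht ▸ Submodule.mem_top)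
  suffices hdesc : ∀ m : ℕ, b ∈ H.W (k + m) → b ∈ H.W k from hdesc _ start
  intro m
  induction m with
  | zero => simp
  | succ m ih =>
    intro hbm
    refine ih ?_
    have h := mem_W_pred_of_map_mem_W₂ g₁ g₂
      (show k < k + ((m + 1 : ℕ) : ℤ) by push_cast; omega) hker hb₁ hb₂ hbm
    have e : k + ((m + 1 : ℕ) : ℤ) - 1 = k + (m : ℕ) := by push_cast; ring
    rwa [e] at h

/-- **Weights `≤ k` pass to the middle term, two test morphisms**: `ker g₁ ∩ ker g₂ ⊆ W_k H`,
`W_k H₁ = H₁`, `W_k H₂ = H₂` give `W_k H = H`. [cite: CattaniElZeinGriffithsLe2014, Cor. 3.2.21 (ii)] -/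
theorem W_eq_top_of_map₂ (g₁ : Hom H H₁) (g₂ : Hom H H₂) {k : ℤ}
    (hker : LinearMap.ker g₁.toLinearMap ⊓ LinearMap.ker g₂.toLinearMap ≤ H.W k)
    (h₁ : H₁.W k = ⊤) (h₂ : H₂.W k = ⊤) : H.W k = ⊤ :=
  eq_top_iff.2 fun _ _ ↦ mem_W_of_map_mem_W₂ g₁ g₂ hker (h₁.symm ▸ Submodule.mem_top)
    (h₂.symm ▸ Submodule.mem_top)

/-- The joint-kernel hypothesis from exactness: `ker g₁ ∩ ker g₂ ⊆ im f` for a morphism of MHS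
`f : H_A → H` with `W_k H_A = H_A` gives `ker g₁ ∩ ker g₂ ⊆ W_k H`. [folklore] -/
theorem inf_ker_le_W_of_le_range₂ (g₁ : Hom H H₁) (g₂ : Hom H H₂) {VA : Type*} [AddCommGroup VA]
    [Module ℚ VA] {HA : MixedHodgeStructure VA} (f : Hom HA H) {k : ℤ} (hA : HA.W k = ⊤)
    (hex : LinearMap.ker g₁.toLinearMap ⊓ LinearMap.ker g₂.toLinearMap ≤
      LinearMap.range f.toLinearMap) :
    LinearMap.ker g₁.toLinearMap ⊓ LinearMap.ker g₂.toLinearMap ≤ H.W k := by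
  refine hex.trans ?_
  rintro _ ⟨a, rfl⟩
  exact f.map_W_le k ⟨a, hA.symm ▸ Submodule.mem_top, rfl⟩

end MixedHodgeStructure

/-! ### The Mayer–Vietoris property of a morphism of pairs at `Hⁿ⁺¹(X)` -/

namespace SchemePair

variable {k : Type} [Field k] [Algebra k ℂ] {Y Y' : SchemePair k}

omit [Algebra k ℂ] in
/-- For a morphism of pairs `φ : (X̃, F) ⟶ (X, D)`, the two composites
`(X̃, ∅) → (X, ∅) → (X, D)` and `(X̃, ∅) → (X̃, F) → (X, D)` agree (both are `φ_X` on the ambient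
scheme and the empty morphism on the closed part). [folklore] -/
lemma Hom.ofScheme_fX_comp_ofSchemeHom (φ : Y' ⟶ Y) :
    Hom.ofScheme φ.fX ≫ ofSchemeHom Y = ofSchemeHom Y' ≫ φ :=
  hom_ext (by simp) (Over.OverMorphism.ext (Scheme.empty_ext _ _))

/-- Naturality of `j^* : Hⁿ(X, D) → Hⁿ(X)` in the morphism of pairs:
`φ_X^* (j_X^* u) = j_{X̃}^* (φ^* u)` (Hatcher 2002, §3.1 p. 200). [cite: Hatcher2002, §3.1 p. 200] -/
lemma bettiCohomology.map_ofScheme_fX_map_ofSchemeHom (φ : Y' ⟶ Y) (n : ℕ)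
    (u : Y.bettiCohomology n) :
    bettiCohomology.map (Hom.ofScheme φ.fX) n (bettiCohomology.map (ofSchemeHom Y) n u) =
      bettiCohomology.map (ofSchemeHom Y') n (bettiCohomology.map φ n u) := by
  rw [← ModuleCat.comp_apply, ← bettiCohomology.map_comp, Hom.ofScheme_fX_comp_ofSchemeHom,
    bettiCohomology.map_comp, ModuleCat.comp_apply]

/-- **Mayer–Vietoris property at `Hⁿ⁺¹(X)` of a morphism of pairs `φ : (X̃, F) ⟶ (X, D)`**: a class
`y ∈ Hⁿ⁺¹(X(ℂ); ℚ)` with `φ_X^* y = 0` in `Hⁿ⁺¹(X̃)` and `y|_D = 0` in `Hⁿ⁺¹(D)` is `j_X^* u` for a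
relative class `u ∈ Hⁿ⁺¹(X, D)` whose pull-back `φ^* u ∈ Hⁿ⁺¹(X̃, F)` is a boundary `∂ v`,
`v ∈ Hⁿ(F)` — exactness of the sequences of the two pairs at `Hⁿ⁺¹((X, ∅))` and at
`Hⁿ⁺¹((X̃, F))` and naturality of `j^*`. When `φ^*` is bijective this says that the joint kernel of
`(φ_X^*, ·|_D)` is contained in the image of `Hⁿ(F) →∂ Hⁿ⁺¹(X̃, F) ≅ Hⁿ⁺¹(X, D) →j Hⁿ⁺¹(X)`
(the Mayer–Vietoris sequence of an abstract blow-up square). [cite: Hatcher2002, §3.1 p. 200] -/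
theorem exists_boundary_of_map_eq_zero (φ : Y' ⟶ Y) (n : ℕ)
    (y : (ofScheme Y.X).bettiCohomology (n + 1))
    (h1 : bettiCohomology.map (Hom.ofScheme φ.fX) (n + 1) y = 0)
    (h2 : bettiCohomology.map (Hom.ofScheme Y.ι) (n + 1) y = 0) :
    ∃ (v : (ofScheme Y'.D).bettiCohomology n) (u : Y.bettiCohomology (n + 1)),
      bettiCohomology.map φ (n + 1) u = bettiCohomology.boundary Y' n v ∧
        bettiCohomology.map (ofSchemeHom Y) (n + 1) u = y := by
  obtain ⟨u, hu⟩ := (ShortComplex.moduleCat_exact_iff _).1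
    (exact_map_ofSchemeHom_map_ofScheme Y (n + 1)) y h2
  have h1' : bettiCohomology.map (ofSchemeHom Y') (n + 1) (bettiCohomology.map φ (n + 1) u) = 0 := by
    rw [← bettiCohomology.map_ofScheme_fX_map_ofSchemeHom,
      show bettiCohomology.map (ofSchemeHom Y) (n + 1) u = y from hu, h1]
  obtain ⟨v, hv⟩ := (ShortComplex.moduleCat_exact_iff _).1
    (exact_boundary_map_ofSchemeHom Y' n) _ h1'
  exact ⟨v, u, hv.symm, hu⟩

/-! #### Naturality of the connecting homomorphism; `Hⁿ(D) ↪ Hⁿ(F)` -/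

/-- The square of continuous maps behind the naturality of the connecting homomorphism: for a
morphism of pairs `φ : (X̃, F) ⟶ (X, D)`, restricting `φ_X(ℂ)` to `ι'(F(ℂ)) → ι(D(ℂ))` and
composing with `F(ℂ) ≃ ι'(F(ℂ))` is `φ_D(ℂ)` followed by `D(ℂ) ≃ ι(D(ℂ))` (`φ.comm`). [folklore] -/
lemma Hom.subHomeomorph_symm_comp_restrictPair (φ : Y' ⟶ Y) :
    (Y.subHomeomorph.symm : C(↥(Y.pointsSub ℂ), ComplexPoints Y.D)).comp
        (relSingularCohomology.restrictPair (AlgPoints.mapContinuous (L := ℂ) φ.fX)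
          (Hom.mapsTo_pointsSub_mapContinuous φ)) =
      (AlgPoints.mapContinuous (L := ℂ) φ.fD).comp
        (Y'.subHomeomorph.symm : C(↥(Y'.pointsSub ℂ), ComplexPoints Y'.D)) := by
  refine ContinuousMap.ext fun Q ↦ ?_
  obtain ⟨P, rfl⟩ := Y'.subHomeomorph.surjective Q
  change Y.subHomeomorph.symm (relSingularCohomology.restrictPair
      (AlgPoints.mapContinuous (L := ℂ) φ.fX) (Hom.mapsTo_pointsSub_mapContinuous φ)
        (Y'.subHomeomorph P)) =
    AlgPoints.map φ.fD (Y'.subHomeomorph.symm (Y'.subHomeomorph P))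
  rw [Homeomorph.symm_apply_apply, Homeomorph.symm_apply_eq]
  refine Subtype.ext ?_
  change AlgPoints.map φ.fX (Y'.subHomeomorph P : ComplexPoints Y'.X) =
    (Y.subHomeomorph (AlgPoints.map φ.fD P) : ComplexPoints Y.X)
  rw [subHomeomorph_apply_coe, subHomeomorph_apply_coe, ← AlgPoints.map_comp_apply,
    ← AlgPoints.map_comp_apply, φ.comm]

/-- Naturality of `subIso : Hⁿ((D, ∅)) ≅ Hⁿ(ι(D(ℂ)))` in the morphism of pairs: pulling back along
`φ_D` and then identifying is identifying and then pulling back along the restriction of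
`φ_X(ℂ)` to `ι'(F(ℂ)) → ι(D(ℂ))`. [folklore] -/
lemma bettiCohomology.map_ofScheme_fD_comp_subIso_hom (φ : Y' ⟶ Y) (n : ℕ) :
    bettiCohomology.map (Hom.ofScheme φ.fD) n ≫ (subIso Y' n).hom =
      (subIso Y n).hom ≫ singularCohomology.map ℚ ℚ
        (relSingularCohomology.restrictPair (AlgPoints.mapContinuous (L := ℂ) φ.fX)
          (Hom.mapsTo_pointsSub_mapContinuous φ)) n := by
  have h := relSingularCohomology.map_comp_toAbsolute (R := ℚ) (M := ℚ)
    (AlgPoints.mapContinuous (L := ℂ) (Hom.ofScheme φ.fD).fX)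
    (Hom.mapsTo_pointsSub_mapContinuous (Hom.ofScheme φ.fD)) n
  rw [subIso, subIso, Iso.trans_hom, Iso.trans_hom, absIso_hom, absIso_hom, ← Category.assoc]
  change (bettiCohomology.map (Hom.ofScheme φ.fD) n ≫ _) ≫ singularCohomology.map ℚ ℚ _ n = _
  rw [h, Category.assoc, ← singularCohomology.map_comp]
  change _ ≫ singularCohomology.map ℚ ℚ ((AlgPoints.mapContinuous (L := ℂ) φ.fD).comp
    (Y'.subHomeomorph.symm : C(↥(Y'.pointsSub ℂ), ComplexPoints Y'.D))) n =
    (_ ≫ singularCohomology.map ℚ ℚ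
      (Y.subHomeomorph.symm : C(↥(Y.pointsSub ℂ), ComplexPoints Y.D)) n) ≫ _
  rw [← Hom.subHomeomorph_symm_comp_restrictPair, singularCohomology.map_comp]
  exact (Category.assoc _ _ _).symm

/-- **Naturality of the connecting homomorphism in pair form**: for a morphism of pairs
`φ : (X̃, F) ⟶ (X, D)`, `φ^* ∘ ∂_{(X,D)} = ∂_{(X̃,F)} ∘ (φ_D)^*` on `Hⁿ((D, ∅)) → Hⁿ⁺¹((X̃, F))`
(Hatcher 2002, §3.1 p. 200; the tree's `relSingularCohomology.δ_comp_map` transported along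
`subIso`, `boundary_eq`). This is the naturality left out of `SchemePairLongExactSequence`.
[cite: Hatcher2002, §3.1 p. 200] -/
theorem bettiCohomology.boundary_comp_map (φ : Y' ⟶ Y) (n : ℕ) :
    bettiCohomology.boundary Y n ≫ bettiCohomology.map φ (n + 1) =
      bettiCohomology.map (Hom.ofScheme φ.fD) n ≫ bettiCohomology.boundary Y' n := by
  rw [boundary_eq, boundary_eq, Category.assoc, relSingularCohomology.δ_comp_map,
    ← Category.assoc, ← Category.assoc, bettiCohomology.map_ofScheme_fD_comp_subIso_hom]

/-- **`Hⁿ(D) ↪ Hⁿ(F)` across a morphism of pairs with bijective relative pull-backs.** Let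
`φ : (X̃, F) ⟶ (X, D)` be a morphism of pairs with `φ^* : Hⁿ(X, D) → Hⁿ(X̃, F)` surjective,
`φ^* : Hⁿ⁺¹(X, D) → Hⁿ⁺¹(X̃, F)` injective (excision for an abstract blow-up square) and
`φ_X^* : Hⁿ(X) → Hⁿ(X̃)` injective (e.g. `φ_X` birational between smooth projective varieties).
Then `φ_D^* : Hⁿ(D(ℂ); ℚ) → Hⁿ(F(ℂ); ℚ)` is injective. Diagram chase on the two long exact
sequences: `∂ y = 0` because `φ^* ∂ y = ∂ φ_D^* y = 0` (naturality), so `y = x|_D`; then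
`φ_X^* x` dies on `F`, hence `φ_X^* x = j'(φ^* t) = φ_X^* (j t)` and `x = j t` restricts to `0`
on `D`. (With the mixed Hodge structures: `Hⁿ(D)` is then a sub-MHS of `Hⁿ(F)`, e.g. for a
principalization `X̃ → X` of `D ⊂ X` with exceptional divisor `F`, reducing weight questions on
the arbitrary projective `D` to the normal crossings divisor `F`.) [cite: Hatcher2002, §3.1 p. 200] -/
theorem bettiCohomology.map_fD_injective (φ : Y' ⟶ Y) (n : ℕ)
    (heS : Function.Surjective (bettiCohomology.map φ n))
    (heI : Function.Injective (bettiCohomology.map φ (n + 1)))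
    (hX : Function.Injective (bettiCohomology.map (Hom.ofScheme φ.fX) n)) :
    Function.Injective (bettiCohomology.map (Hom.ofScheme φ.fD) n) := by
  refine (injective_iff_map_eq_zero _).2 fun y hy ↦ ?_
  -- `∂ y = 0` by naturality and injectivity of `φ^*` in degree `n + 1`
  have hδ : bettiCohomology.boundary Y n y = 0 := by
    apply heI
    rw [map_zero, ← ModuleCat.comp_apply, bettiCohomology.boundary_comp_map, ModuleCat.comp_apply,
      hy, map_zero]
  obtain ⟨x, hx⟩ := (ShortComplex.moduleCat_exact_iff _).1 (exact_map_ofScheme_boundary Y n) y hδ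
  -- `φ_X^* x` dies on `F`
  have hsq : Hom.ofScheme Y'.ι ≫ Hom.ofScheme φ.fX = Hom.ofScheme φ.fD ≫ Hom.ofScheme Y.ι :=
    hom_ext φ.comm.symm rfl
  have h1 : bettiCohomology.map (Hom.ofScheme Y'.ι) n
      (bettiCohomology.map (Hom.ofScheme φ.fX) n x) = 0 := by
    rw [← ModuleCat.comp_apply, ← bettiCohomology.map_comp, hsq, bettiCohomology.map_comp,
      ModuleCat.comp_apply, show bettiCohomology.map (Hom.ofScheme Y.ι) n x = y from hx, hy]
  obtain ⟨t', ht'⟩ := (ShortComplex.moduleCat_exact_iff _).1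
    (exact_map_ofSchemeHom_map_ofScheme Y' n) _ h1
  obtain ⟨t, rfl⟩ := heS t'
  -- `φ_X^* x = j' (φ^* t) = φ_X^* (j t)`, so `x = j t`
  have ht : bettiCohomology.map (Hom.ofScheme φ.fX) n (bettiCohomology.map (ofSchemeHom Y) n t) =
      bettiCohomology.map (Hom.ofScheme φ.fX) n x := by
    rw [bettiCohomology.map_ofScheme_fX_map_ofSchemeHom]
    exact ht'
  have hxt : x = bettiCohomology.map (ofSchemeHom Y) n t := (hX ht).symm
  -- `y = x|_D = (j t)|_D = 0`
  change bettiCohomology.map (Hom.ofScheme Y.ι) n x = y at hx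
  rw [← hx, hxt, ← ModuleCat.comp_apply, map_ofSchemeHom_comp_map_ofScheme]
  rfl

end SchemePair

/-! ### Weights across the square -/

namespace MixedHodgeStructureOfPair

variable {k : Type} [Field k] [Algebra k ℂ] (M : MixedHodgeStructureOfPair k)

/-- **The Mayer–Vietoris step on weights** (Deligne, Hodge III, the induction behind
Thm. 8.2.4 (iii) and Prop. 8.2.5, one step, on the package `M`). Let `φ : (X̃, F) ⟶ (X, D)` be a
morphism of pairs of varieties with `φ^* : Hⁿ⁺¹(X, D) → Hⁿ⁺¹(X̃, F)` bijective (an abstract blow-up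
square), and assume `W_w Hⁿ(F) = Hⁿ(F)`. Then every `y ∈ Hⁿ⁺¹(X(ℂ); ℚ)` with
`φ_X^* y ∈ W_w Hⁿ⁺¹(X̃)` and `y|_D ∈ W_w Hⁿ⁺¹(D)` lies in `W_w Hⁿ⁺¹(X)`. Proof: the joint kernel of
`(φ_X^*, ·|_D)` lies in the image of the composite morphism of MHS
`Hⁿ(F) →∂ Hⁿ⁺¹(X̃, F) →(φ^*)⁻¹ Hⁿ⁺¹(X, D) →j Hⁿ⁺¹(X)` (`SchemePair.exists_boundary_of_map_eq_zero`;
`boundary_hom`, `Hom.exists_inverse`, `map_hom`), whose source has `W_w = ⊤`, and the weight test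
`mem_W_of_map_mem_W₂` (exactness of `Gr^W`) applies.
[cite: DeligneHodgeIII1974, Prop. 8.2.5 and Thm. 8.2.4 (iii)]
[cite: CattaniElZeinGriffithsLe2014, Cor. 3.2.21 (ii)] -/
theorem mem_W_of_bijective_map {Y Y' : SchemePair k} (hY : Y.IsVarietyPair)
    (hY' : Y'.IsVarietyPair) (φ : Y' ⟶ Y) (n : ℕ)
    (he : Function.Bijective (SchemePair.bettiCohomology.map φ (n + 1))) {w : ℤ}
    (hF : (M.mhs (SchemePair.ofScheme Y'.D) n).W w = ⊤)
    {y : (SchemePair.ofScheme Y.X).bettiCohomology (n + 1)}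
    (h1 : SchemePair.bettiCohomology.map (SchemePair.Hom.ofScheme φ.fX) (n + 1) y ∈
      (M.mhs (SchemePair.ofScheme Y'.X) (n + 1)).W w)
    (h2 : SchemePair.bettiCohomology.map (SchemePair.Hom.ofScheme Y.ι) (n + 1) y ∈
      (M.mhs (SchemePair.ofScheme Y.D) (n + 1)).W w) :
    y ∈ (M.mhs (SchemePair.ofScheme Y.X) (n + 1)).W w := by
  -- the test morphisms `φ_X^*` and `·|_D`, and the morphisms building the connecting map
  set g₁ := M.mapHom hY'.ofScheme_X hY.ofScheme_X (SchemePair.Hom.ofScheme φ.fX) (n + 1) with hg₁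
  set g₂ := M.mapHom hY.ofScheme_D hY.ofScheme_X (SchemePair.Hom.ofScheme Y.ι) (n + 1) with hg₂
  set e := M.mapHom hY' hY φ (n + 1) with hedef
  have he' : Function.Bijective e.toLinearMap := by
    rw [hedef, M.mapHom_toLinearMap]
    exact he
  obtain ⟨einv, heinv, -⟩ := e.exists_inverse_apply he'
  set j := M.mapHom hY.ofScheme_X hY (SchemePair.ofSchemeHom Y) (n + 1) with hj
  set d := M.boundaryHom hY' n with hd
  have hg₁b : g₁.toLinearMap y ∈ (M.mhs (SchemePair.ofScheme Y'.X) (n + 1)).W w := by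
    rw [hg₁, M.mapHom_toLinearMap]; exact h1
  have hg₂b : g₂.toLinearMap y ∈ (M.mhs (SchemePair.ofScheme Y.D) (n + 1)).W w := by
    rw [hg₂, M.mapHom_toLinearMap]; exact h2
  refine MixedHodgeStructure.mem_W_of_map_mem_W₂ g₁ g₂
    (MixedHodgeStructure.inf_ker_le_W_of_le_range₂ g₁ g₂ (j.comp (einv.comp d)) hF ?_) hg₁b hg₂b
  -- the joint kernel lies in the image of `j ∘ (φ^*)⁻¹ ∘ ∂`
  rintro x ⟨hx₁, hx₂⟩
  rw [SetLike.mem_coe, LinearMap.mem_ker] at hx₁ hx₂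
  rw [hg₁, M.mapHom_toLinearMap] at hx₁
  rw [hg₂, M.mapHom_toLinearMap] at hx₂
  obtain ⟨v, u, hvu, huy⟩ := SchemePair.exists_boundary_of_map_eq_zero φ n x hx₁ hx₂
  refine ⟨v, ?_⟩
  rw [MixedHodgeStructure.Hom.comp_toLinearMap, MixedHodgeStructure.Hom.comp_toLinearMap,
    LinearMap.comp_apply, LinearMap.comp_apply]
  have hdv : d.toLinearMap v = e.toLinearMap u := by
    rw [hd, M.boundaryHom_toLinearMap, hedef, M.mapHom_toLinearMap]
    exact hvu.symm
  rw [hdv, heinv, hj, M.mapHom_toLinearMap]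
  exact huy

/-- **Weights `≤ w` across the square** (the inductive step of Hodge III, Thm. 8.2.4 (iii),
"si `X` est propre, alors `p + q ≤ n`", on the package `M`): for a morphism of pairs of varieties
`φ : (X̃, F) ⟶ (X, D)` with `φ^* : Hⁿ⁺¹(X, D) → Hⁿ⁺¹(X̃, F)` bijective, if `W_w Hⁿ(F) = Hⁿ(F)`,
`W_w Hⁿ⁺¹(X̃) = Hⁿ⁺¹(X̃)` and `W_w Hⁿ⁺¹(D) = Hⁿ⁺¹(D)`, then `W_w Hⁿ⁺¹(X) = Hⁿ⁺¹(X)`.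
[cite: DeligneHodgeIII1974, Thm. 8.2.4 (iii)] [cite: CattaniElZeinGriffithsLe2014, Cor. 3.2.21 (ii)] -/
theorem W_eq_top_of_bijective_map {Y Y' : SchemePair k} (hY : Y.IsVarietyPair)
    (hY' : Y'.IsVarietyPair) (φ : Y' ⟶ Y) (n : ℕ)
    (he : Function.Bijective (SchemePair.bettiCohomology.map φ (n + 1))) {w : ℤ}
    (hF : (M.mhs (SchemePair.ofScheme Y'.D) n).W w = ⊤)
    (hX' : (M.mhs (SchemePair.ofScheme Y'.X) (n + 1)).W w = ⊤)
    (hD : (M.mhs (SchemePair.ofScheme Y.D) (n + 1)).W w = ⊤) :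
    (M.mhs (SchemePair.ofScheme Y.X) (n + 1)).W w = ⊤ :=
  eq_top_iff.2 fun _ _ ↦ M.mem_W_of_bijective_map hY hY' φ n he hF (hX'.symm ▸ Submodule.mem_top)
    (hD.symm ▸ Submodule.mem_top)

/-- **Prop. 8.2.5, inductive step, in the shape it is used** (`w = n`, `φ_X^* y = 0`): for an
abstract blow-up square `φ : (X̃, F) ⟶ (X, D)` (pairs of varieties, `φ^*` bijective on `Hⁿ⁺¹`) with
`W_n Hⁿ(F) = Hⁿ(F)` (weights of the proper `F`, Thm. 8.2.4 (iii)), a class `y ∈ Hⁿ⁺¹(X)` dying on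
`X̃` whose restriction to `D` has weight `≤ n` has weight `≤ n`: `y ∈ W_n Hⁿ⁺¹(X)`.
[cite: DeligneHodgeIII1974, Prop. 8.2.5] -/
theorem mem_W_of_bijective_map_of_map_eq_zero {Y Y' : SchemePair k} (hY : Y.IsVarietyPair)
    (hY' : Y'.IsVarietyPair) (φ : Y' ⟶ Y) (n : ℕ)
    (he : Function.Bijective (SchemePair.bettiCohomology.map φ (n + 1)))
    (hF : (M.mhs (SchemePair.ofScheme Y'.D) n).W n = ⊤)
    {y : (SchemePair.ofScheme Y.X).bettiCohomology (n + 1)}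
    (h1 : SchemePair.bettiCohomology.map (SchemePair.Hom.ofScheme φ.fX) (n + 1) y = 0)
    (h2 : SchemePair.bettiCohomology.map (SchemePair.Hom.ofScheme Y.ι) (n + 1) y ∈
      (M.mhs (SchemePair.ofScheme Y.D) (n + 1)).W n) :
    y ∈ (M.mhs (SchemePair.ofScheme Y.X) (n + 1)).W n :=
  M.mem_W_of_bijective_map hY hY' φ n he hF (by rw [h1]; exact Submodule.zero_mem _) h2

end MixedHodgeStructureOfPair

/-! ### The weight box at the level of `W`; degree `0` -/

namespace MixedHodgeStructure

variable {V : Type*} [AddCommGroup V] [Module ℚ V] (H : MixedHodgeStructure V)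

/-- **`Gr^W_w = 0` when all its Hodge pieces vanish**: then `W_{w-1} = W_w` (the Hodge
decomposition `ℂ ⊗ Gr^W_w = ⊕_p (Gr^W_w)^{p,w-p}`, `HodgeStructure.iSup_piece_eq_top_holds`,
and `ℚ`-rationality). This converts piece-level vanishing (the box axiom of
`MixedHodgeStructureOfPair`, Hodge III Thm. 8.2.4) into statements on the weight filtration.
[cite: DeligneHodgeII1971, 1.2.5] -/
theorem W_pred_eq_of_forall_piece_eq_bot {w : ℤ} (h : ∀ p q : ℤ, (H.gr w).piece p q = ⊥) :
    H.W (w - 1) = H.W w := by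
  refine le_antisymm (H.monotone_W (by omega)) fun x hx ↦ ?_
  have htop : (⊤ : Submodule ℂ (ℂ ⊗[ℚ] grW H.W w)) = ⊥ := by
    rw [← HodgeStructure.iSup_piece_eq_top_holds (H.gr w)]
    exact iSup_eq_bot.2 fun p ↦ h p (w - p)
  have hm : (Submodule.Quotient.mk ⟨x, hx⟩ : grW H.W w) ∈ (⊥ : Submodule ℚ (grW H.W w)) := by
    refine mem_of_one_tmul_mem_baseChange ⊥ ?_
    rw [Submodule.baseChange_bot, ← htop]
    exact Submodule.mem_top
  rw [Submodule.mem_bot, Submodule.Quotient.mk_eq_zero] at hm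
  exact hm

/-- **Weights `≤ a` from the vanishing of the pieces above `a`**: if every Hodge piece of every
`Gr^W_w`, `w > a`, vanishes, then `W_a = V` (descend from an exhausting step). [folklore] -/
theorem W_eq_top_of_forall_piece_eq_bot_of_lt {a : ℤ}
    (h : ∀ w, a < w → ∀ p q : ℤ, (H.gr w).piece p q = ⊥) : H.W a = ⊤ := by
  obtain ⟨t, ht⟩ := H.exists_W_eq_top
  have key : ∀ m : ℕ, H.W (a + m) = ⊤ → H.W a = ⊤ := by
    intro m
    induction m with
    | zero => simp
    | succ m ih =>
      intro hm
      refine ih ?_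
      have e := H.W_pred_eq_of_forall_piece_eq_bot (h (a + ((m + 1 : ℕ) : ℤ)) (by push_cast; omega))
      rw [hm, show a + ((m + 1 : ℕ) : ℤ) - 1 = a + (m : ℕ) by push_cast; ring] at e
      exact e
  rcases le_or_gt a t with hat | hat
  · exact key (t - a).toNat (by rwa [Int.toNat_of_nonneg (by omega), add_sub_cancel])
  · exact top_unique (ht.symm.le.trans (H.monotone_W hat.le))

/-- **Weights `> b` from the vanishing of the pieces up to `b`**: if every Hodge piece of every
`Gr^W_w`, `w ≤ b`, vanishes, then `W_b = 0`. [folklore] -/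
theorem W_eq_bot_of_forall_piece_eq_bot_of_le {b : ℤ}
    (h : ∀ w, w ≤ b → ∀ p q : ℤ, (H.gr w).piece p q = ⊥) : H.W b = ⊥ := by
  obtain ⟨s, hs⟩ := H.exists_W_eq_bot
  have key : ∀ m : ℕ, H.W (b - m) = ⊥ → H.W b = ⊥ := by
    intro m
    induction m with
    | zero => simp
    | succ m ih =>
      intro hm
      refine ih ?_
      have e := H.W_pred_eq_of_forall_piece_eq_bot (h (b - ((m : ℕ) : ℤ)) (by omega))
      rw [show b - ((m : ℕ) : ℤ) - 1 = b - ((m + 1 : ℕ) : ℤ) by push_cast; ring, hm] at e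
      exact e.symm
  rcases le_or_gt s b with hsb | hsb
  · exact key (b - s).toNat (by rwa [Int.toNat_of_nonneg (by omega), sub_sub_cancel])
  · exact eq_bot_iff.2 ((H.monotone_W hsb.le).trans hs.le)

end MixedHodgeStructure

namespace MixedHodgeStructureOfPair

variable {k : Type} [Field k] [Algebra k ℂ] (M : MixedHodgeStructureOfPair k)

/-- **The weights of `Hⁿ(X(ℂ), D(ℂ); ℚ)` are `≤ 2n`** for a pair of varieties, at the level of the
weight filtration: `W_{2n} Hⁿ = Hⁿ` (Hodge III, Thm. 8.2.4: `h^{p,q} = 0` unless `0 ≤ p, q ≤ n`;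
the tree's `piece_eq_bot_of_weight_not_mem` with `W_pred_eq_of_forall_piece_eq_bot`).
[cite: DeligneHodgeIII1974, Thm. 8.2.4] -/
theorem W_two_mul_eq_top {Y : SchemePair k} (hY : Y.IsVarietyPair) (n : ℕ) :
    (M.mhs Y n).W (2 * n) = ⊤ :=
  (M.mhs Y n).W_eq_top_of_forall_piece_eq_bot_of_lt fun _ hw p q ↦
    M.piece_eq_bot_of_weight_not_mem hY n (Or.inr hw) p q

/-- **The weights of `Hⁿ(X(ℂ), D(ℂ); ℚ)` are `≥ 0`** for a pair of varieties: `W_{-1} Hⁿ = 0`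
(Hodge III, Thm. 8.2.4). [cite: DeligneHodgeIII1974, Thm. 8.2.4] -/
theorem W_neg_one_eq_bot {Y : SchemePair k} (hY : Y.IsVarietyPair) (n : ℕ) :
    (M.mhs Y n).W (-1) = ⊥ :=
  (M.mhs Y n).W_eq_bot_of_forall_piece_eq_bot_of_le fun _ hw p q ↦
    M.piece_eq_bot_of_weight_not_mem hY n (Or.inl (by omega)) p q

/-- **`H⁰(X(ℂ), D(ℂ); ℚ)` is pure of weight `0`** for every pair of varieties (the box
`[0, 0]²`; Hodge III, Thm. 8.2.4) — the degree-`0` base of the inductions on weights.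
[cite: DeligneHodgeIII1974, Thm. 8.2.4] -/
theorem isPure_zero {Y : SchemePair k} (hY : Y.IsVarietyPair) : (M.mhs Y 0).IsPure 0 := by
  refine ⟨fun j hj ↦ ?_, fun j hj ↦ ?_⟩
  · exact eq_bot_iff.2 (((M.mhs Y 0).monotone_W (show j ≤ -1 by omega)).trans
      (M.W_neg_one_eq_bot hY 0).le)
  · exact eq_top_iff.2 ((M.W_two_mul_eq_top hY 0).symm.le.trans
      ((M.mhs Y 0).monotone_W (show (2 * (0 : ℕ) : ℤ) ≤ j by push_cast; omega)))

end MixedHodgeStructureOfPair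

end Literature.AlgebraicGeometry.Motives

end
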